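import Literature.NumberTheory.CubicFields.CubicFieldDiscriminant7683
import HarnessLib

/-!
# The cubic field of discriminant `−7683` (LMFDB 3.1.7683.1), part 2: the primes above `2, 3, 5, 7` of norm `≤ 24` are principal — PROVED

Sequel of `CubicFieldDiscriminant7683.lean` (same seat bsd-line-att-p4 g44, same namespace `Literature.NumberTheory.CubicFields.CubicDisc7683`; part 1:
`f`, `g`, `𝓞_F = ℤ ⊕ ℤθ ⊕ ℤδ`, the Dedekind–Kummer exponents, `d_F = −7683`, signature).  THEOREMS ONLY; every statement PROVED.
§3 (first half, split for the 400-line rule): every prime of `𝓞_F` above `p ∈ {2, 3, 5, 7}` with `p^f ≤ 24` is principal — Dedekind–Kummer through `θ`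
(`p ≠ 3`) or `δ` (`p = 3`, `3 = 𝔮²𝔮′` ramified) and EXPLICIT GENERATORS in `ℤ ⊕ ℤθ ⊕ ℤδ` (norm-form search on the LLL-reduced integral basis, pure Python):
`(2, θ) = (−83 + 14θ + 27δ)` (norm `2`: the degree-one dyadic prime `𝔭₁` of the cell's `2`-adic doors IS principal), `(2, θ² + θ + 1) = (6698 + 1906θ + 1305δ)`
(norm `4`), `(3, δ) = (120 − 13θ + 43δ)` (ramified), `(3, δ + 2) = (−4 + θ + 5δ)`, `(5, θ) = (443 − 53θ + 102δ)`, `(7, θ + 1) = (−11 − 3θ − 2δ)`; the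
degree-two primes above `5, 7` have norm `> 24`.  Each ideal identity is two memberships and one pair-membership, checked in `F` by `linear_combination`
against `f(α) = 0` with `δ = (α² − 5α − 21)/9`.  Part 3 (`…ClassNumber`): `p = 11 … 23` and ★ `h_F = 1`.
Written for the rank-`0` u7 seed `[1, 0, 0, −9, −12]` (conductor `7683`) of crux C2's census (cell `bsd-f1-sign2`, route `AlignedTransportAtTwo`).

References: [LMFDB] number field 3.1.7683.1 (class number 1); [Marcus2018] Ch. 3 Thm. 27.
-/

noncomputable section

open Polynomial NumberField NumberField.InfinitePlace Ideal Module Real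
open Literature.NumberTheory.NumberFields
open Literature.NumberTheory.NumberFields.MonicCubic

namespace Literature.NumberTheory.CubicFields.CubicDisc7683

section NumberField

variable {F : Type*} [Field F] [NumberField F] {α : F}

/-! ## §3 The primes of norm `≤ 24` are principal: `p ≤ 7` -/

/-- `(2, θ) = (-83 + 14 * θ + 27 * δ)`, an element of norm `2` (identities checked in `F`, `δ = (α ^ 2 - 5 * α - 21) / 9`).
[cite: Marcus2018, Ch. 3, Thm. 27] -/
theorem span_2_lin0_eq (hα : aeval α (poly 1 (-33) (-180)) = 0) :
    span {(2 : 𝓞 F), thetaInt hα} = span {-83 + 14 * thetaInt hα + 27 * thetaInt (delta_root hα)} := by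
  apply le_antisymm
  · rw [span_le]
    rintro x hx
    rcases hx with rfl | hx
    · exact mem_span_singleton'.mpr ⟨6698 + 1906 * thetaInt hα + 1305 * thetaInt (delta_root hα), by
          rw [RingOfIntegers.ext_iff]
          simp only [map_mul, map_add, map_neg, map_ofNat, MonicCubic.thetaInt, RingOfIntegers.map_mk]
          linear_combination (((2963 : F)) + ((435 : F)) * α) * cubic_eq hα⟩
    · rw [Set.mem_singleton_iff.mp hx]
      exact mem_span_singleton'.mpr ⟨23928 + 6809 * thetaInt hα + 4662 * thetaInt (delta_root hα), by
          rw [RingOfIntegers.ext_iff]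
          simp only [map_mul, map_add, map_neg, map_ofNat, MonicCubic.thetaInt, RingOfIntegers.map_mk]
          linear_combination (((10585 : F)) + ((1554 : F)) * α) * cubic_eq hα⟩
  · rw [span_singleton_le_iff_mem, mem_span_pair]
    exact ⟨830 + 387 * thetaInt (delta_root hα), 429 - 83 * thetaInt hα, by
        rw [RingOfIntegers.ext_iff]
        simp only [map_mul, map_add, map_sub, map_neg, map_ofNat, MonicCubic.thetaInt, RingOfIntegers.map_mk]
        linear_combination (0 : F) * cubic_eq hα⟩

/-- `(2, θ ^ 2 + θ + 1) = (6698 + 1906 * θ + 1305 * δ)`, an element of norm `4` (identities checked in `F`, `δ = (α ^ 2 - 5 * α - 21) / 9`).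
[cite: Marcus2018, Ch. 3, Thm. 27] -/
theorem span_2_quad_eq (hα : aeval α (poly 1 (-33) (-180)) = 0) :
    span {(2 : 𝓞 F), thetaInt hα ^ 2 + thetaInt hα + 1} = span {6698 + 1906 * thetaInt hα + 1305 * thetaInt (delta_root hα)} := by
  apply le_antisymm
  · rw [span_le]
    rintro x hx
    rcases hx with rfl | hx
    · exact mem_span_singleton'.mpr ⟨-83 + 14 * thetaInt hα + 27 * thetaInt (delta_root hα), by
          rw [RingOfIntegers.ext_iff]
          simp only [map_mul, map_add, map_neg, map_ofNat, MonicCubic.thetaInt, RingOfIntegers.map_mk]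
          linear_combination (((2963 : F)) + ((435 : F)) * α) * cubic_eq hα⟩
    · rw [Set.mem_singleton_iff.mp hx]
      exact mem_span_singleton'.mpr ⟨-625 + 70 * thetaInt hα - 198 * thetaInt (delta_root hα), by
          rw [RingOfIntegers.ext_iff]
          simp only [map_mul, map_add, map_sub, map_neg, map_pow, map_ofNat, map_one, MonicCubic.thetaInt, RingOfIntegers.map_mk]
          linear_combination (((3308 : F)) + ((-3190 : F)) * α) * cubic_eq hα⟩
  · rw [span_singleton_le_iff_mem, mem_span_pair]
    exact ⟨-11006 - 2962 * thetaInt hα - 5220 * thetaInt (delta_root hα), 1305, by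
        rw [RingOfIntegers.ext_iff]
        simp only [map_mul, map_add, map_sub, map_neg, map_pow, map_ofNat, map_one, MonicCubic.thetaInt, RingOfIntegers.map_mk]
        linear_combination (0 : F) * cubic_eq hα⟩

/-- **Every prime of `𝓞_F` above `2` is principal** (Dedekind–Kummer through `θ`, `2 ∤ exponent`, with `polyMod_2` and the generators above).
[cite: Marcus2018, Ch. 3, Thm. 27] [cite: LMFDB, number field 3.1.7683.1 (class number 1)] -/
theorem isPrincipal_of_mem_primesOver_2 (h3 : finrank ℚ F = 3) (hα : aeval α (poly 1 (-33) (-180)) = 0) {P : Ideal (𝓞 F)}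
    (hP : P ∈ primesOver (span {((2 : ℕ) : ℤ)}) (𝓞 F)) : Submodule.IsPrincipal P := by
  haveI : Fact (Nat.Prime 2) := ⟨by norm_num⟩
  obtain ⟨Qb, hirr, hmon, hdvd, -, hspan⟩ :=
    exists_factor_of_mem_primesOver' irreducible_polyQ hα (by norm_num : Nat.Prime 2)
      (not_dvd_exponent h3 hα (by norm_num) (by norm_num)) hP
  rw [polyMod_2] at hdvd
  rcases hirr.prime.dvd_or_dvd hdvd with h | h
  · have hQb : Qb = X := eq_of_monic_of_associated hmon monic_X (hirr.associated_of_dvd irreducible_X h)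
    have hPeq := hspan X (by rw [hQb, Polynomial.map_X])
    rw [aeval_X, Nat.cast_ofNat, span_2_lin0_eq hα] at hPeq
    exact ⟨⟨-83 + 14 * thetaInt hα + 27 * thetaInt (delta_root hα), by rw [hPeq, Ideal.submodule_span_eq]⟩⟩
  · have hQb : Qb = X ^ 2 + X + 1 :=
      eq_of_monic_of_associated hmon (by monicity!) (hirr.associated_of_dvd CubicDisc307.irreducible_quad_two h)
    have hPeq := hspan (X ^ 2 + X + 1) (by rw [hQb]; simp)
    rw [show aeval (thetaInt hα) (X ^ 2 + X + 1 : ℤ[X]) = thetaInt hα ^ 2 + thetaInt hα + 1 by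
        simp only [map_add, map_pow, aeval_X, map_one], Nat.cast_ofNat, span_2_quad_eq hα] at hPeq
    exact ⟨⟨6698 + 1906 * thetaInt hα + 1305 * thetaInt (delta_root hα), by rw [hPeq, Ideal.submodule_span_eq]⟩⟩

/-- `(3, δ) = (120 - 13 * θ + 43 * δ)`, an element of norm `3` (identities checked in `F`, `δ = (α ^ 2 - 5 * α - 21) / 9`).
[cite: Marcus2018, Ch. 3, Thm. 27] -/
theorem span_3_dlin0_eq (hα : aeval α (poly 1 (-33) (-180)) = 0) :
    span {(3 : 𝓞 F), thetaInt (delta_root hα)} = span {120 - 13 * thetaInt hα + 43 * thetaInt (delta_root hα)} := by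
  apply le_antisymm
  · rw [span_le]
    rintro x hx
    rcases hx with rfl | hx
    · exact mem_span_singleton'.mpr ⟨31863 + 9067 * thetaInt hα + 6208 * thetaInt (delta_root hα), by
          rw [RingOfIntegers.ext_iff]
          simp only [map_mul, map_add, map_sub, map_ofNat, MonicCubic.thetaInt, RingOfIntegers.map_mk]
          linear_combination (((-153791 : F) / 81) + ((266944 : F) / 81) * α) * cubic_eq hα⟩
    · rw [Set.mem_singleton_iff.mp hx]
      exact mem_span_singleton'.mpr ⟨-6698 - 1906 * thetaInt hα - 1305 * thetaInt (delta_root hα), by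
          rw [RingOfIntegers.ext_iff]
          simp only [map_mul, map_add, map_sub, map_neg, map_ofNat, MonicCubic.thetaInt, RingOfIntegers.map_mk]
          linear_combination (((3592 : F) / 9) + ((-6235 : F) / 9) * α) * cubic_eq hα⟩
  · rw [span_singleton_le_iff_mem, mem_span_pair]
    exact ⟨-12 + 13 * thetaInt hα, 199 + 26 * thetaInt hα, by
        rw [RingOfIntegers.ext_iff]
        simp only [map_mul, map_add, map_sub, map_neg, map_ofNat, MonicCubic.thetaInt, RingOfIntegers.map_mk]
        linear_combination (((26 : F) / 9)) * cubic_eq hα⟩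

/-- `(3, δ + 2) = (-4 + θ + 5 * δ)`, an element of norm `-3` (identities checked in `F`, `δ = (α ^ 2 - 5 * α - 21) / 9`).
[cite: Marcus2018, Ch. 3, Thm. 27] -/
theorem span_3_dlin2_eq (hα : aeval α (poly 1 (-33) (-180)) = 0) :
    span {(3 : 𝓞 F), thetaInt (delta_root hα) + 2} = span {-4 + thetaInt hα + 5 * thetaInt (delta_root hα)} := by
  apply le_antisymm
  · rw [span_le]
    rintro x hx
    rcases hx with rfl | hx
    · exact mem_span_singleton'.mpr ⟨-123 - 35 * thetaInt hα - 24 * thetaInt (delta_root hα), by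
          rw [RingOfIntegers.ext_iff]
          simp only [map_mul, map_add, map_sub, map_neg, map_ofNat, MonicCubic.thetaInt, RingOfIntegers.map_mk]
          linear_combination (((-157 : F) / 27) + ((-40 : F) / 27) * α) * cubic_eq hα⟩
    · rw [Set.mem_singleton_iff.mp hx]
      exact mem_span_singleton'.mpr ⟨-56 - 16 * thetaInt hα - 11 * thetaInt (delta_root hα), by
          rw [RingOfIntegers.ext_iff]
          simp only [map_mul, map_add, map_sub, map_neg, map_ofNat, MonicCubic.thetaInt, RingOfIntegers.map_mk]
          linear_combination (((-214 : F) / 81) + ((-55 : F) / 81) * α) * cubic_eq hα⟩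
  · rw [span_singleton_le_iff_mem, mem_span_pair]
    exact ⟨-4 + thetaInt hα + 4 * thetaInt (delta_root hα), -2 - thetaInt (delta_root hα), by
        rw [RingOfIntegers.ext_iff]
        simp only [map_mul, map_add, map_sub, map_neg, map_ofNat, MonicCubic.thetaInt, RingOfIntegers.map_mk]
        linear_combination (((11 : F) / 81) + ((-1 : F) / 81) * α) * cubic_eq hα⟩

/-- **Every prime of `𝓞_F` above `3` is principal** (Dedekind–Kummer through `δ`, `3 ∤ exponent`, with `polyModDelta_3` and the generators above).
[cite: Marcus2018, Ch. 3, Thm. 27] [cite: LMFDB, number field 3.1.7683.1 (class number 1)] -/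
theorem isPrincipal_of_mem_primesOver_3 (h3 : finrank ℚ F = 3) (hα : aeval α (poly 1 (-33) (-180)) = 0) {P : Ideal (𝓞 F)}
    (hP : P ∈ primesOver (span {((3 : ℕ) : ℤ)}) (𝓞 F)) : Submodule.IsPrincipal P := by
  haveI : Fact (Nat.Prime 3) := ⟨by norm_num⟩
  obtain ⟨Qb, hirr, hmon, hdvd, -, hspan⟩ :=
    exists_factor_of_mem_primesOver' irreducible_polyQ_delta (delta_root hα) (by norm_num : Nat.Prime 3)
      (not_dvd_exponent_delta h3 hα (by norm_num) (by norm_num)) hP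
  rw [polyModDelta_3] at hdvd
  rcases hirr.prime.dvd_or_dvd hdvd with h12 | h
  · rcases hirr.prime.dvd_or_dvd h12 with h | h
    · have hQb : Qb = X := eq_of_monic_of_associated hmon monic_X (hirr.associated_of_dvd irreducible_X h)
      have hPeq := hspan X (by rw [hQb, Polynomial.map_X])
      rw [aeval_X, Nat.cast_ofNat, span_3_dlin0_eq hα] at hPeq
      exact ⟨⟨120 - 13 * thetaInt hα + 43 * thetaInt (delta_root hα), by rw [hPeq, Ideal.submodule_span_eq]⟩⟩
    · have hQb : Qb = X := eq_of_monic_of_associated hmon monic_X (hirr.associated_of_dvd irreducible_X h)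
      have hPeq := hspan X (by rw [hQb, Polynomial.map_X])
      rw [aeval_X, Nat.cast_ofNat, span_3_dlin0_eq hα] at hPeq
      exact ⟨⟨120 - 13 * thetaInt hα + 43 * thetaInt (delta_root hα), by rw [hPeq, Ideal.submodule_span_eq]⟩⟩
  · have hirr1 : Irreducible (X + 2 : (ZMod 3)[X]) := by
      rw [show (X + 2 : (ZMod 3)[X]) = X - C (-2) by rw [map_neg, map_ofNat]; ring]
      exact irreducible_X_sub_C _
    have hQb : Qb = X + 2 := eq_of_monic_of_associated hmon (by monicity!) (hirr.associated_of_dvd hirr1 h)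
    have hPeq := hspan (X + C 2) (by rw [hQb]; simp [map_ofNat])
    rw [show aeval (thetaInt (delta_root hα)) (X + C 2 : ℤ[X]) = thetaInt (delta_root hα) + 2 by
        simp only [map_add, aeval_X, aeval_C, algebraMap_int_eq, Int.coe_castRingHom, Int.cast_ofNat], Nat.cast_ofNat, span_3_dlin2_eq hα] at hPeq
    exact ⟨⟨-4 + thetaInt hα + 5 * thetaInt (delta_root hα), by rw [hPeq, Ideal.submodule_span_eq]⟩⟩

/-- `(5, θ) = (443 - 53 * θ + 102 * δ)`, an element of norm `-5` (identities checked in `F`, `δ = (α ^ 2 - 5 * α - 21) / 9`).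
[cite: Marcus2018, Ch. 3, Thm. 27] -/
theorem span_5_lin0_eq (hα : aeval α (poly 1 (-33) (-180)) = 0) :
    span {(5 : 𝓞 F), thetaInt hα} = span {443 - 53 * thetaInt hα + 102 * thetaInt (delta_root hα)} := by
  apply le_antisymm
  · rw [span_le]
    rintro x hx
    rcases hx with rfl | hx
    · exact mem_span_singleton'.mpr ⟨-309848 - 88171 * thetaInt hα - 60369 * thetaInt (delta_root hα), by
          rw [RingOfIntegers.ext_iff]
          simp only [map_mul, map_add, map_sub, map_neg, map_ofNat, MonicCubic.thetaInt, RingOfIntegers.map_mk]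
          linear_combination (((1732117 : F) / 9) + ((-684182 : F) / 9) * α) * cubic_eq hα⟩
    · rw [Set.mem_singleton_iff.mp hx]
      exact mem_span_singleton'.mpr ⟨-442761 - 125993 * thetaInt hα - 86265 * thetaInt (delta_root hα), by
          rw [RingOfIntegers.ext_iff]
          simp only [map_mul, map_add, map_sub, map_neg, map_ofNat, MonicCubic.thetaInt, RingOfIntegers.map_mk]
          linear_combination (((825043 : F) / 3) + ((-108630 : F)) * α) * cubic_eq hα⟩
  · rw [span_singleton_le_iff_mem, mem_span_pair]
    exact ⟨-1772 - 777 * thetaInt (delta_root hα), -2268 + 443 * thetaInt hα, by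
        rw [RingOfIntegers.ext_iff]
        simp only [map_mul, map_add, map_sub, map_neg, map_ofNat, MonicCubic.thetaInt, RingOfIntegers.map_mk]
        linear_combination (0 : F) * cubic_eq hα⟩

/-- **Every prime of `𝓞_F` above `5` with `5^f ≤ 24` is principal** (Dedekind–Kummer through `θ`, `5 ∤ exponent`, with `polyMod_5` and the generators above).
[cite: Marcus2018, Ch. 3, Thm. 27] [cite: LMFDB, number field 3.1.7683.1 (class number 1)] -/
theorem isPrincipal_of_mem_primesOver_5 (h3 : finrank ℚ F = 3) (hα : aeval α (poly 1 (-33) (-180)) = 0) {P : Ideal (𝓞 F)}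
    (hP : P ∈ primesOver (span {((5 : ℕ) : ℤ)}) (𝓞 F))
    (hle : 5 ^ P.inertiaDeg ℤ ≤ 24) : Submodule.IsPrincipal P := by
  haveI : Fact (Nat.Prime 5) := ⟨by norm_num⟩
  obtain ⟨Qb, hirr, hmon, hdvd, hdeg, hspan⟩ :=
    exists_factor_of_mem_primesOver' irreducible_polyQ hα (by norm_num : Nat.Prime 5)
      (not_dvd_exponent h3 hα (by norm_num) (by norm_num)) hP
  rw [polyMod_5] at hdvd
  rcases hirr.prime.dvd_or_dvd hdvd with h | h
  · have hQb : Qb = X := eq_of_monic_of_associated hmon monic_X (hirr.associated_of_dvd irreducible_X h)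
    have hPeq := hspan X (by rw [hQb, Polynomial.map_X])
    rw [aeval_X, Nat.cast_ofNat, span_5_lin0_eq hα] at hPeq
    exact ⟨⟨443 - 53 * thetaInt hα + 102 * thetaInt (delta_root hα), by rw [hPeq, Ideal.submodule_span_eq]⟩⟩
  · have hQb : Qb = X ^ 2 + X + 2 :=
      eq_of_monic_of_associated hmon (by monicity!) (hirr.associated_of_dvd CubicDisc4883.irreducible_quad_5 h)
    exfalso
    have hd2 : (X ^ 2 + X + 2 : (ZMod 5)[X]).natDegree = 2 := by compute_degree!
    rw [hdeg, hQb, hd2] at hle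
    norm_num at hle

/-- `(7, θ + 1) = (-11 - 3 * θ - 2 * δ)`, an element of norm `-7` (identities checked in `F`, `δ = (α ^ 2 - 5 * α - 21) / 9`).
[cite: Marcus2018, Ch. 3, Thm. 27] -/
theorem span_7_lin1_eq (hα : aeval α (poly 1 (-33) (-180)) = 0) :
    span {(7 : 𝓞 F), thetaInt hα + 1} = span {-11 - 3 * thetaInt hα - 2 * thetaInt (delta_root hα)} := by
  apply le_antisymm
  · rw [span_le]
    rintro x hx
    rcases hx with rfl | hx
    · exact mem_span_singleton'.mpr ⟨-8 + thetaInt hα - thetaInt (delta_root hα), by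
          rw [RingOfIntegers.ext_iff]
          simp only [map_mul, map_add, map_sub, map_neg, map_ofNat, MonicCubic.thetaInt, RingOfIntegers.map_mk]
          linear_combination (((-13 : F) / 81) + ((2 : F) / 81) * α) * cubic_eq hα⟩
    · rw [Set.mem_singleton_iff.mp hx]
      exact mem_span_singleton'.mpr ⟨1 + 2 * thetaInt (delta_root hα), by
          rw [RingOfIntegers.ext_iff]
          simp only [map_mul, map_add, map_sub, map_neg, map_ofNat, map_one, MonicCubic.thetaInt, RingOfIntegers.map_mk]
          linear_combination (((-10 : F) / 81) + ((-4 : F) / 81) * α) * cubic_eq hα⟩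
  · rw [span_singleton_le_iff_mem, mem_span_pair]
    exact ⟨-16 * thetaInt hα + 10 * thetaInt (delta_root hα), 157 - 8 * thetaInt hα, by
        rw [RingOfIntegers.ext_iff]
        simp only [map_mul, map_add, map_sub, map_neg, map_ofNat, map_one, MonicCubic.thetaInt, RingOfIntegers.map_mk]
        linear_combination (0 : F) * cubic_eq hα⟩

/-- **Every prime of `𝓞_F` above `7` with `7^f ≤ 24` is principal** (Dedekind–Kummer through `θ`, `7 ∤ exponent`, with `polyMod_7` and the generators above).
[cite: Marcus2018, Ch. 3, Thm. 27] [cite: LMFDB, number field 3.1.7683.1 (class number 1)] -/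
theorem isPrincipal_of_mem_primesOver_7 (h3 : finrank ℚ F = 3) (hα : aeval α (poly 1 (-33) (-180)) = 0) {P : Ideal (𝓞 F)}
    (hP : P ∈ primesOver (span {((7 : ℕ) : ℤ)}) (𝓞 F))
    (hle : 7 ^ P.inertiaDeg ℤ ≤ 24) : Submodule.IsPrincipal P := by
  haveI : Fact (Nat.Prime 7) := ⟨by norm_num⟩
  obtain ⟨Qb, hirr, hmon, hdvd, hdeg, hspan⟩ :=
    exists_factor_of_mem_primesOver' irreducible_polyQ hα (by norm_num : Nat.Prime 7)
      (not_dvd_exponent h3 hα (by norm_num) (by norm_num)) hP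
  rw [polyMod_7] at hdvd
  rcases hirr.prime.dvd_or_dvd hdvd with h | h
  · have hirr1 : Irreducible (X + 1 : (ZMod 7)[X]) := by
      rw [show (X + 1 : (ZMod 7)[X]) = X - C (-1) by rw [map_neg, map_one, sub_neg_eq_add]]
      exact irreducible_X_sub_C _
    have hQb : Qb = X + 1 := eq_of_monic_of_associated hmon (by monicity!) (hirr.associated_of_dvd hirr1 h)
    have hPeq := hspan (X + 1) (by rw [hQb]; simp)
    rw [show aeval (thetaInt hα) (X + 1 : ℤ[X]) = thetaInt hα + 1 by
        simp only [map_add, aeval_X, map_one], Nat.cast_ofNat, span_7_lin1_eq hα] at hPeq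
    exact ⟨⟨-11 - 3 * thetaInt hα - 2 * thetaInt (delta_root hα), by rw [hPeq, Ideal.submodule_span_eq]⟩⟩
  · have hQb : Qb = X ^ 2 + 2 :=
      eq_of_monic_of_associated hmon (by monicity!) (hirr.associated_of_dvd irreducible_quad_7 h)
    exfalso
    have hd2 : (X ^ 2 + 2 : (ZMod 7)[X]).natDegree = 2 := by compute_degree!
    rw [hdeg, hQb, hd2] at hle
    norm_num at hle

end NumberField

end Literature.NumberTheory.CubicFields.CubicDisc7683

end
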